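import Summits.ValiantsHypothesis.ValiantsHypothesis.Theorems.BarrierLeverChowThinRowsTwinPeelAll

/-!
# Route BarrierLever — item `ChowHitsThinRowPartitionMinors` (stmt-ValiantsHypothesis-20195):
# TWIN PEELING VI — one pair move over a small shadow, spelled out

Helper file (`--supports stmt-ValiantsHypothesis-20195`; cell valiant-natproofs, rung V4, 𝒟-side of
door (c); prover seat valiant-natproofs-prover gen 11).  Closes NO item; imports only the seat's
`…ChowThinRowsTwinPeelAll` (parts I–V; no route file).

`chowHits_firstOrderRows_of_onePairPeel`: the simplest instance of the pair move (part IV) as a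
ready-to-use slice theorem — a coordinate `c` whose twin pairs `{w j, w j ∪ {c}}` among the columns sit
over at most two bases `w₁ ∋ d`, `w₂ ∌ d` (both columns, `c ∉ w₁, w₂`, `c ≠ d`), such that the
down-closure of `{w j \\ c} ∪ {(w j \\ c) \\ d}` has at most `h + h - 2` members.  Then every partition
minor with injective rows of size `≤ 1` and these columns is nonzero at an explicit product of `h + h`
affine forms (item 20195's matrix verbatim).  Typical use: the dense 8-subsets of `2^[4]` at `h = 7`
left open by parts I–III (seat census `lab/peel_k2.py`: all of them are one pair move over a
sub-cube).

WHAT THIS IS NOT: one stage only (chain stages with `chowHits_firstOrderRows_of_peeling`); nothing on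
rows of size 2, on items 20172 / 19717, on crux stmt-ValiantsHypothesis-14610, or on `VP` versus `VNP`.
-/

set_option linter.dupNamespace false

namespace Summit.ValiantsHypothesis.ValiantsHypothesis.Theorems.BarrierLever.ChowTwinPeel

open Finset MvPolynomial

variable {h : ℕ}

/-- **One pair move over a small shadow** (item 20195, first-order rows; see the module docstring). -/
theorem chowHits_firstOrderRows_of_onePairPeel (h : ℕ) (c d : Fin h) (hcd : c ≠ d)
    (w₁ w₂ : Finset (Fin h)) (hdw₁ : d ∈ w₁) (hdw₂ : d ∉ w₂) (hcw₁ : c ∉ w₁) (hcw₂ : c ∉ w₂)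
    (r : ℕ) (u w : Fin r → Finset (Fin h))
    (hu : Function.Injective u) (hw : Function.Injective w) (hu1 : ∀ i, (u i).card ≤ 1)
    (hw₁ : ∃ j, w j = w₁) (hw₂ : ∃ j, w j = w₂)
    (htwin : ∀ j j', c ∉ w j → w j' = insert c (w j) → w j = w₁ ∨ w j = w₂)
    (hbudget : ((((Finset.univ : Finset (Fin r)).image (fun j => (w j).erase c)) ∪
      ((Finset.univ : Finset (Fin r)).image (fun j => ((w j).erase c).erase d))).biUnion
        Finset.powerset).card + 2 ≤ h + h) :
    ∃ ℓ : Fin (h + h) → MvPolynomial (Fin (h + h)) ℂ, (∀ k, (ℓ k).totalDegree ≤ 1) ∧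
      (Matrix.of fun i j : Fin r => MvPolynomial.coeff
        (∑ a ∈ u i, Finsupp.single (Fin.castAdd h a) 1 +
          ∑ c ∈ w j, Finsupp.single (Fin.natAdd h c) 1) (∏ k, ℓ k)).det ≠ 0 := by
  classical
  obtain ⟨j₁, hj₁⟩ := hw₁
  obtain ⟨j₂, hj₂⟩ := hw₂
  refine chowHits_firstOrderRows_of_peeling h 1
    (fun t => if t = 0 then (Finset.univ : Finset (Fin r)).image w else
      ((Finset.univ : Finset (Fin r)).image (fun j => (w j).erase c)) ∪
      ((Finset.univ : Finset (Fin r)).image (fun j => ((w j).erase c).erase d)))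
    (fun _ => c) (fun _ => d) (fun _ => true) (fun _ => w₁) (fun _ => w₂)
    (fun s hs t ht _ => by omega) (fun t ht hp => absurd hp (by decide)) ?_ ?_ r u w hu hw hu1
    (fun j => by rw [if_pos rfl]; exact Finset.mem_image_of_mem w (Finset.mem_univ j))
  · intro t ht _
    have ht0 : t = 0 := by omega
    subst ht0
    refine ⟨?_, hcd, hdw₁, hdw₂, ?_, ?_, hcw₁, hcw₂, ?_⟩
    · rw [if_pos rfl, if_neg (by omega), Finset.image_image, Finset.image_image]
      rfl
    · rw [if_pos rfl, ← hj₁]; exact Finset.mem_image_of_mem w (Finset.mem_univ j₁)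
    · rw [if_pos rfl, ← hj₂]; exact Finset.mem_image_of_mem w (Finset.mem_univ j₂)
    · intro W hW hcW hins
      rw [if_pos rfl, Finset.mem_image] at hW hins
      obtain ⟨j, _, rfl⟩ := hW
      obtain ⟨j', _, hj'⟩ := hins
      exact htwin j j' hcW hj'
  · rw [if_neg (by omega), Finset.sum_range_one, if_pos rfl]
    exact hbudget

end Summit.ValiantsHypothesis.ValiantsHypothesis.Theorems.BarrierLever.ChowTwinPeel
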